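import Mathlib
import HarnessLib
import HarnessLib.Audit
import Summits.ValiantsHypothesis.ValiantsHypothesis.Theorems.SoloBlindCoreVertexBound

/-!
# The core vertex bound: the typed conjecture needs `0 ∉ V` — refutation of the typed form and the repaired statement

`CoreVertexBound` (file `SoloBlindCoreVertexBound`) encodes the conjecture "the number of non-generator
vertices of the `C`-convex lattice polygon `H = conv V + cone Q` with `V ⊆ S₀ = ℕQ` is at most
`#(S₀ ∖ H)`".  As typed it quantifies over ALL finite `V`, including `V = {0}`: then `H = cone Q ⊇ S₀`,
no semigroup point is separated from `V`, `D = ∅` is admissible, and the conclusion reads `1 ≤ 0`.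
So the typed statement is false for a degenerate reason (`not_coreVertexBound`, witness `Q = ∅`,
`V = {(0,0)}`, `D = ∅`).  In the intended setting (the reduction from `Newt(fg+1)`, `paper/R1struct.md`
§8 of this seat's notes) the origin is always a deleted point (`0 ∈ S₀ ∖ H`), i.e. `0 ∉ V`.  The repaired
conjecture `CoreVertexBoundPos` adds exactly this hypothesis; the tightness witness of
`coreVertexBound_tight` satisfies it (`coreVertexBoundPos_tight`), and the clean form follows from it as
before (`card_le_of_coreVertexBoundPos`).

References: Koiran–Portier–Tavenas–Thomassé 2015 (arXiv:1308.2286) §5, problem 1.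
-/

namespace Summit.ValiantsHypothesis.ValiantsHypothesis.Theorems

/-- The typed conjecture `CoreVertexBound` is false: with `Q = ∅`, `V = {(0,0)}`, `D = ∅` all three
hypotheses hold (the only semigroup point is `0`, which is not strictly separated from `V = {0}`), while
`#(V ∖ Q) = 1 > 0 = #D`.  The same witness works for any `Q` in an open half-plane (then `H = cone Q`
swallows `S₀`).  This is a degenerate-case defect of the encoding, not evidence against the geometric
statement, whose instances always have `0 ∉ V`; see `CoreVertexBoundPos`. -/
theorem not_coreVertexBound : ¬ CoreVertexBound := by
  intro h
  have key := h ∅ {((0 : ℤ), (0 : ℤ))} ∅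
    (by
      intro v hv
      simp only [Finset.mem_singleton] at hv
      subst hv
      exact zero_mem _)
    (by
      intro v hv
      refine ⟨0, 0, by simp, ?_⟩
      intro w hw hne
      simp only [Finset.mem_singleton] at hv hw
      exact absurd (hw.trans hv.symm) hne)
    (by
      rintro y hy ⟨a, b, -, hsep⟩
      have hy0 : y = 0 := by
        simpa [Finset.coe_empty, AddSubmonoid.closure_empty] using hy
      subst hy0
      have := hsep ((0 : ℤ), (0 : ℤ)) (by simp)
      simp at this)
  simp at key

/-- **Core vertex bound, repaired** (conjecture).  As `CoreVertexBound`, with the missing hypothesis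
`(0,0) ∉ V` (the origin is never a vertex: it is a deleted point in every instance coming from
`Newt(fg+1)`).  For finite `Q V D ⊆ ℤ²`: if `0 ∉ V`, every `v ∈ V` lies in `S₀ = ℕQ` and is a strict
vertex of `H = conv V + cone Q` (integer functional positive on `Q`, uniquely minimised over `V` at `v`),
and `D` contains every semigroup point strictly separated from `V` by a functional nonnegative on `Q`
(i.e. `D ⊇ S₀ ∖ H`), then `#(V ∖ Q) ≤ #D`.  CONJECTURAL — a `Prop`, not asserted; tight by
`coreVertexBoundPos_tight`; evidence: 0 violations in ≈ 6·10⁵ exact instances (all with `0 ∉ V`). -/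
@[conjecture] def CoreVertexBoundPos : Prop :=
  ∀ (Q V D : Finset (ℤ × ℤ)), ((0 : ℤ), (0 : ℤ)) ∉ V →
    (∀ v ∈ V, v ∈ AddSubmonoid.closure (↑Q : Set (ℤ × ℤ))) →
    (∀ v ∈ V, ∃ a b : ℤ, (∀ q ∈ Q, 0 < a * q.1 + b * q.2) ∧
        ∀ w ∈ V, w ≠ v → a * v.1 + b * v.2 < a * w.1 + b * w.2) →
    (∀ y ∈ AddSubmonoid.closure (↑Q : Set (ℤ × ℤ)),
        (∃ a b : ℤ, (∀ q ∈ Q, 0 ≤ a * q.1 + b * q.2) ∧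
          ∀ w ∈ V, a * y.1 + b * y.2 < a * w.1 + b * w.2) → y ∈ D) →
    (V \ Q).card ≤ D.card

/-- The repaired conjecture is tight: the witness of `coreVertexBound_tight`
(`Q = {(1,1),(4,3),(5,6)}`, five composite vertices, five outside points) has `0 ∉ V`. -/
theorem coreVertexBoundPos_tight :
    ∃ Q V D : Finset (ℤ × ℤ), ((0 : ℤ), (0 : ℤ)) ∉ V ∧
      (∀ v ∈ V, v ∈ AddSubmonoid.closure (↑Q : Set (ℤ × ℤ))) ∧
      (∀ v ∈ V, ∃ a b : ℤ, (∀ q ∈ Q, 0 < a * q.1 + b * q.2) ∧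
          ∀ w ∈ V, w ≠ v → a * v.1 + b * v.2 < a * w.1 + b * w.2) ∧
      (∀ y ∈ AddSubmonoid.closure (↑Q : Set (ℤ × ℤ)),
          (∃ a b : ℤ, (∀ q ∈ Q, 0 ≤ a * q.1 + b * q.2) ∧
            ∀ w ∈ V, a * y.1 + b * y.2 < a * w.1 + b * w.2) → y ∈ D) ∧
      (V \ Q).card = D.card := by
  refine ⟨{(1, 1), (4, 3), (5, 6)}, {(8, 6), (5, 4), (3, 3), (6, 7), (10, 12)},
    {(0, 0), (1, 1), (2, 2), (4, 3), (5, 6)}, by decide, ?_, ?_, ?_, by decide⟩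
  · have hg : ∀ q ∈ ({(1, 1), (4, 3), (5, 6)} : Finset (ℤ × ℤ)),
        q ∈ AddSubmonoid.closure (↑({(1, 1), (4, 3), (5, 6)} : Finset (ℤ × ℤ)) : Set (ℤ × ℤ)) :=
      fun q hq => AddSubmonoid.subset_closure (Finset.mem_coe.mpr hq)
    have h11 := hg (1, 1) (by decide)
    have h43 := hg (4, 3) (by decide)
    have h56 := hg (5, 6) (by decide)
    intro v hv
    simp only [Finset.mem_insert, Finset.mem_singleton] at hv
    rcases hv with rfl | rfl | rfl | rfl | rfl
    · simpa using add_mem h43 h43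
    · simpa using add_mem h11 h43
    · simpa using add_mem (add_mem h11 h11) h11
    · simpa using add_mem h11 h56
    · simpa using add_mem h56 h56
  · intro v hv
    simp only [Finset.mem_insert, Finset.mem_singleton] at hv
    rcases hv with rfl | rfl | rfl | rfl | rfl
    · exact ⟨-30, 44, by decide, by decide⟩
    · exact ⟨-3, 5, by decide, by decide⟩
    · exact ⟨1, 1, by decide, by decide⟩
    · exact ⟨9, -7, by decide, by decide⟩
    · exact ⟨31, -25, by decide, by decide⟩
  · intro y hy
    have hg : ∀ q ∈ ({(1, 1), (4, 3), (5, 6)} : Finset (ℤ × ℤ)),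
        q ∈ AddSubmonoid.closure (↑({(1, 1), (4, 3), (5, 6)} : Finset (ℤ × ℤ)) : Set (ℤ × ℤ)) :=
      fun q hq => AddSubmonoid.subset_closure (Finset.mem_coe.mpr hq)
    have h11 := hg (1, 1) (by decide)
    have key : ∀ x ∈ ({(0, 0), (1, 1), (2, 2), (4, 3), (5, 6)} : Finset (ℤ × ℤ)),
        ∀ z ∈ ({(0, 0), (1, 1), (2, 2), (4, 3), (5, 6)} : Finset (ℤ × ℤ)),
          x + z ∈ ({(0, 0), (1, 1), (2, 2), (4, 3), (5, 6)} : Finset (ℤ × ℤ)) ∨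
          ∃ w ∈ ({(8, 6), (5, 4), (3, 3), (6, 7), (10, 12)} : Finset (ℤ × ℤ)),
            ∃ c ∈ ({(0, 0), (1, 1), (6, 6)} : Finset (ℤ × ℤ)), x + z = w + c := by
      decide
    have hCs : ∀ c ∈ ({(0, 0), (1, 1), (6, 6)} : Finset (ℤ × ℤ)),
        c ∈ AddSubmonoid.closure (↑({(1, 1), (4, 3), (5, 6)} : Finset (ℤ × ℤ)) : Set (ℤ × ℤ)) := by
      intro c hc
      simp only [Finset.mem_insert, Finset.mem_singleton] at hc
      rcases hc with rfl | rfl | rfl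
      · exact zero_mem _
      · exact h11
      · simpa using add_mem (add_mem (add_mem h11 h11) (add_mem h11 h11)) (add_mem h11 h11)
    have P : y ∈ ({(0, 0), (1, 1), (2, 2), (4, 3), (5, 6)} : Finset (ℤ × ℤ)) ∨
        ∃ w ∈ ({(8, 6), (5, 4), (3, 3), (6, 7), (10, 12)} : Finset (ℤ × ℤ)),
          ∃ c ∈ AddSubmonoid.closure (↑({(1, 1), (4, 3), (5, 6)} : Finset (ℤ × ℤ)) : Set (ℤ × ℤ)),
            y = w + c := by
      induction hy using AddSubmonoid.closure_induction with
      | mem x hx =>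
        left
        have hx' := Finset.mem_coe.mp hx
        simp only [Finset.mem_insert, Finset.mem_singleton] at hx'
        rcases hx' with rfl | rfl | rfl <;> decide
      | zero => left; decide
      | add x z hx hz ihx ihz =>
        rcases ihx with hxD | ⟨w, hw, c, hc, rfl⟩
        · rcases ihz with hzD | ⟨w, hw, c, hc, rfl⟩
          · rcases key x hxD z hzD with h | ⟨w, hw, c, hc, h⟩
            · exact Or.inl h
            · exact Or.inr ⟨w, hw, c, hCs c hc, h⟩
          · exact Or.inr ⟨w, hw, x + c, add_mem hx hc, by rw [add_left_comm]⟩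
        · exact Or.inr ⟨w, hw, c + z, add_mem hc hz, by rw [add_assoc]⟩
    intro hsep
    rcases P with hD | ⟨w, hw, c, hc, hyc⟩
    · exact hD
    · exact absurd hsep (not_separated_of_eq_add hw hc hyc)

/-- The clean form from the repaired conjecture: if moreover every generator is separated from `V`
(no generator lies in `H`), then `#V ≤ #D`. -/
theorem card_le_of_coreVertexBoundPos (h : CoreVertexBoundPos) (Q V D : Finset (ℤ × ℤ))
    (h0 : ((0 : ℤ), (0 : ℤ)) ∉ V)
    (hS : ∀ v ∈ V, v ∈ AddSubmonoid.closure (↑Q : Set (ℤ × ℤ)))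
    (hV : ∀ v ∈ V, ∃ a b : ℤ, (∀ q ∈ Q, 0 < a * q.1 + b * q.2) ∧
        ∀ w ∈ V, w ≠ v → a * v.1 + b * v.2 < a * w.1 + b * w.2)
    (hD : ∀ y ∈ AddSubmonoid.closure (↑Q : Set (ℤ × ℤ)),
        (∃ a b : ℤ, (∀ q ∈ Q, 0 ≤ a * q.1 + b * q.2) ∧
          ∀ w ∈ V, a * y.1 + b * y.2 < a * w.1 + b * w.2) → y ∈ D)
    (hQ : ∀ q ∈ Q, ∃ a b : ℤ, (∀ q' ∈ Q, 0 ≤ a * q'.1 + b * q'.2) ∧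
        ∀ w ∈ V, a * q.1 + b * q.2 < a * w.1 + b * w.2) :
    V.card ≤ D.card := by
  have hdisj : Disjoint V Q := by
    refine Finset.disjoint_left.mpr ?_
    intro v hvV hvQ
    obtain ⟨a, b, -, hsep⟩ := hQ v hvQ
    exact lt_irrefl _ (hsep v hvV)
  have hVQ : V \ Q = V := Finset.sdiff_eq_self_iff_disjoint.mpr hdisj
  simpa [hVQ] using h Q V D h0 hS hV hD

/-- The repaired conjecture specialised: under `0 ∉ V` it yields exactly the conclusion of the typed
statement (recorded as the precise relation between the two encodings). -/
theorem sdiff_card_le_of_coreVertexBoundPos (h : CoreVertexBoundPos) (Q V D : Finset (ℤ × ℤ))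
    (h0 : ((0 : ℤ), (0 : ℤ)) ∉ V)
    (hS : ∀ v ∈ V, v ∈ AddSubmonoid.closure (↑Q : Set (ℤ × ℤ)))
    (hV : ∀ v ∈ V, ∃ a b : ℤ, (∀ q ∈ Q, 0 < a * q.1 + b * q.2) ∧
        ∀ w ∈ V, w ≠ v → a * v.1 + b * v.2 < a * w.1 + b * w.2)
    (hD : ∀ y ∈ AddSubmonoid.closure (↑Q : Set (ℤ × ℤ)),
        (∃ a b : ℤ, (∀ q ∈ Q, 0 ≤ a * q.1 + b * q.2) ∧
          ∀ w ∈ V, a * y.1 + b * y.2 < a * w.1 + b * w.2) → y ∈ D) :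
    (V \ Q).card ≤ D.card :=
  h Q V D h0 hS hV hD

end Summit.ValiantsHypothesis.ValiantsHypothesis.Theorems
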